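import Summits.CriticalPhenomena.PercolationContinuityZ3.Theorems.PercNearOneGluingNoHeavyConstsMDLXJoint
import Literature.Probability.Percolation.TwoClusterGibbsCovariance
import HarnessLib

/-!
# MDL(X)′ for the van den Berg–Häggström–Kahn Thm 2.1 class `f(C_s, C_X)` (increasing in `C_s`, decreasing in `C_X`) IS MDL(X)′:
# the tower reduction ("MDLX-J ⟺ MDLXJoint", "J2 ⟸ MDLXJoint")
# (PAPER-2 track (ii): constants of the CSH family; seat `prim-consts-2`, gen 11)

builds on p205010 (kernel theorem, internal audit signed; external expert review pending).  Support file (`--supports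
stmt-CriticalPhenomena-4575`); memos `FROM-prim-consts-2-g9-MDLXJOINT.md` §0(3) ("MDLX-J2 … the natural statement to attack") and
`FROM-prim-consts-2-g11-THREESEP.md` §0(5).  No definitions, no named facts, no sorries; standard axioms.

Gens 9–10 conjectured, and the census cells tabulated separately ("MDLX-J2-BERN", nh-lead gen 102), the extension of `Consts.MDLXJoint`
(`Cov_ν(F(C_s), 1{s↔z} − p'·1{s↔y}) ≥ 0` for increasing `F`, `ν = μ(· | s ↮ X)`) to the vdBHK Thm 2.1 class:
  MDLX-J:  `Cov_ν(f(C_s, C_X), 1{s↔z} − p'·1{s↔y}) ≥ 0` for every `f` increasing in the cluster `C_s` and decreasing in `C_X = ⋃_{x∈X} C_x`,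
whose case `f = g(C_X)` (`g` decreasing) is "J2", the covariance half `R2 ≥ 0` of the cylinder split of memo g10 §3.  THIS FILE: MDLX-J is not a
generalisation but a CONSEQUENCE of MDL(X)′ at one explicit increasing functional — by van den Berg–Häggström–Kahn's Lemma 2.3/2.4 (given
`C_s = K` inside `{s ↮ X}`, the cluster of `X` is the cluster of `X` for fresh percolation on `G` minus the pairs meeting `{s} ∪ V(K)`; tree:
`BHK2006.set_sum_cond_cluster`), the conditional mean `f̂(K) = E_η[f(K, C_X(η ∖ B(K)))]` is an INCREASING functional of `K = C_s`
(`Consts.monotone_condJointFn`: `K ⊆ K'` deletes more pairs, `C_X` shrinks, `f` grows in both arguments' directions), and the three integrals of the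
MDL(X)′ inequality — over `D = {s↮X}`, `D ∩ {s↔y}`, `D ∩ {s↔z}`, all `σ(C_s)`-events inside `D` — are unchanged when `f(C_s, C_X)` is replaced by
`f̂(C_s)` (`Consts.tower_jointFn`, `Consts.setIntegral_jointFn_reach_eq`).  Hence:
* `Consts.mdlxJoint_jointClass_of_at` — the MDL(X)′ inequality for `f̂` implies the MDL(X)′ inequality for `f(C_s, C_X)` (any `V`, `w, s, y, z, X`);
* `Consts.mdlxJoint_jointClass` — `Consts.MDLXJoint` ⟹ MDLX-J (all `n, w, s ≠ y, z, X`, all `f` monotone/antitone);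
* `Consts.mdlxJoint_J2` — in particular `Consts.MDLXJoint` ⟹ J2: for `g` antitone, `μ(𝒜∩D∩W)·cov_D(g(C_X); s↔y) ≤ μ(𝒜∩D)·cov_D(g(C_X); s↔z)`.
So "R2 ≥ 0" of the cylinder split is implied by MDL(X)′ itself, and the separate conjecture/census line MDLX-J(2) is subsumed at the level of the
inequality (the Bernstein/three-copy forms are not addressed here).
[cite: VandenbergHaggstromKahn2005, §2.1 Lemma 2.3–2.4 (p. 10), Thm. 2.1 (p. 9)]
-/

noncomputable section

namespace Summit.CriticalPhenomena.PercolationContinuityZ3.Theorems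

open MeasureTheory Set Literature.Probability.LatticeModels Literature.Probability.Percolation
open scoped Classical
open BHK2006 DecisionTree

namespace Consts

variable {V : Type*} [Fintype V]

/-- **The conditional mean of a Thm-2.1-class function is an increasing functional of the owner's cluster**: for `f(K, L)` increasing in `K`
and decreasing in `L`, `K ↦ ∫ f(K, C_X(η ∖ B(K))) dμ(η)` is monotone (`B(K)` = pairs meeting `{s} ∪ V(K)` grows with `K`, so the thinned
configuration and the cluster of `X` in it shrink). [cite: VandenbergHaggstromKahn2005, §2.1 Lemma 2.3 (p. 10); §2.2 p. 12] -/
theorem monotone_condJointFn (w : Sym2 V → unitInterval) (s : V) (X : Set V) (f : Set (Sym2 V) → Set (Sym2 V) → ℝ)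
    (hf₁ : ∀ L, Monotone fun K => f K L) (hf₂ : ∀ K, Antitone fun L => f K L) :
    Monotone fun K : Set (Sym2 V) => ∫ η, f K (setCl (η \ barOf ({s} : Set V) K) X) ∂(prodBernoulli w) := by
  intro K K' hKK'
  refine integral_mono (Integrable.of_finite) (Integrable.of_finite) fun η => ?_
  have hsub : η \ barOf ({s} : Set V) K' ⊆ η \ barOf ({s} : Set V) K :=
    fun e he => ⟨he.1, fun h' => he.2 (barOf_mono ({s} : Set V) hKK' h')⟩
  exact (hf₁ _ hKK').trans (hf₂ K' (setCl_mono hsub X))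

/-- **Tower property along `σ(C_s)` on `{s ↮ X}` for a function of both clusters** (vdBHK Lemma 2.4): for any `f` and any family `𝒮` of
edge sets, `∫_{D ∩ {C_s ∈ 𝒮}} f(C_s, C_X) dμ = ∫_{D ∩ {C_s ∈ 𝒮}} f̂(C_s) dμ` with `D = {s ↮ X}`, `C_X = ⋃_{x∈X} C_x` and
`f̂(K) = ∫ f(K, C_X(η ∖ B(K))) dμ(η)`. [cite: VandenbergHaggstromKahn2005, §2.1 Lemma 2.4 (p. 10)] -/
theorem tower_jointFn (w : Sym2 V → unitInterval) (s : V) (X : Set V) (f : Set (Sym2 V) → Set (Sym2 V) → ℝ)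
    (𝒮 : Set (Set (Sym2 V))) :
    ∫ ω in {ω : BondConfig V | ∀ x ∈ X, ¬ (openGraph ω).Reachable s x} ∩ {ω | openEdgeCluster ω s ∈ 𝒮},
        f (openEdgeCluster ω s) (⋃ x ∈ X, openEdgeCluster ω x) ∂(prodBernoulli w) =
      ∫ ω in {ω : BondConfig V | ∀ x ∈ X, ¬ (openGraph ω).Reachable s x} ∩ {ω | openEdgeCluster ω s ∈ 𝒮},
        (∫ η, f (openEdgeCluster ω s) (setCl (η \ barOf ({s} : Set V) (openEdgeCluster ω s)) X) ∂(prodBernoulli w))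
          ∂(prodBernoulli w) := by
  classical
  set μ := prodBernoulli w with hμ
  set D : Set (BondConfig V) := {ω : BondConfig V | ∀ x ∈ X, ¬ (openGraph ω).Reachable s x} with hD
  have hDiff : ∀ ω : BondConfig V, ω ∈ D ↔ ∀ a ∈ ({s} : Set V), ∀ t ∈ X, ¬ (openGraph ω).Reachable a t := by
    intro ω; simp [hD]
  have hm : ∑ ω : Set (Sym2 V), weight (fun e => (w e : ℝ)) ω = 1 := by
    have h1 := integral_prodBernoulli_eq_sum w fun _ => (1 : ℝ)
    simp only [integral_const, probReal_univ, smul_eq_mul, mul_one] at h1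
    exact h1.symm
  -- the two-cluster identity with `H(K, L) = 1_𝒮(K) · f(K, L)`
  have key := set_sum_cond_cluster (fun e => (w e : ℝ)) hm ({s} : Set V) X (fun K L => ind 𝒮 K * f K L) hDiff
  simp only [setCl_singleton] at key
  have hX : ∀ ω : BondConfig V, setCl ω X = ⋃ x ∈ X, openEdgeCluster ω x := fun ω => rfl
  rw [← integral_indicator (MeasurableSet.of_discrete), ← integral_indicator (MeasurableSet.of_discrete),
    integral_prodBernoulli_eq_sum, integral_prodBernoulli_eq_sum]
  have hL : ∀ ω : BondConfig V, (D ∩ {ω | openEdgeCluster ω s ∈ 𝒮}).indicator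
      (fun ω => f (openEdgeCluster ω s) (⋃ x ∈ X, openEdgeCluster ω x)) ω =
        ind 𝒮 (openEdgeCluster ω s) * f (openEdgeCluster ω s) (setCl ω X) * ind D ω := by
    intro ω
    by_cases h1 : ω ∈ D
    · by_cases h2 : openEdgeCluster ω s ∈ 𝒮
      · rw [indicator_of_mem (show ω ∈ D ∩ {ω | openEdgeCluster ω s ∈ 𝒮} from ⟨h1, h2⟩),
          ind_of_mem h1, ind_of_mem h2, hX]; ring
      · rw [indicator_of_notMem (fun h => h2 h.2), ind_of_not_mem h2]; ring
    · rw [indicator_of_notMem (fun h => h1 h.1), ind_of_not_mem h1]; ring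
  have hR : ∀ ω : BondConfig V, (D ∩ {ω | openEdgeCluster ω s ∈ 𝒮}).indicator
      (fun ω => ∫ η, f (openEdgeCluster ω s) (setCl (η \ barOf ({s} : Set V) (openEdgeCluster ω s)) X) ∂μ) ω =
      (∑ η : Set (Sym2 V), weight (fun e => (w e : ℝ)) η *
        (ind 𝒮 (openEdgeCluster ω s) * f (openEdgeCluster ω s) (setCl (η \ barOf ({s} : Set V) (openEdgeCluster ω s)) X))) *
        ind D ω := by
    intro ω
    have hint : ∫ η, f (openEdgeCluster ω s) (setCl (η \ barOf ({s} : Set V) (openEdgeCluster ω s)) X) ∂μ =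
        ∑ η : Set (Sym2 V), weight (fun e => (w e : ℝ)) η *
          f (openEdgeCluster ω s) (setCl (η \ barOf ({s} : Set V) (openEdgeCluster ω s)) X) := integral_prodBernoulli_eq_sum w _
    by_cases h1 : ω ∈ D
    · by_cases h2 : openEdgeCluster ω s ∈ 𝒮
      · rw [indicator_of_mem (show ω ∈ D ∩ {ω | openEdgeCluster ω s ∈ 𝒮} from ⟨h1, h2⟩),
          ind_of_mem h1, ind_of_mem h2, hint]
        simp only [one_mul, mul_one]
      · rw [indicator_of_notMem (fun h => h2 h.2), ind_of_not_mem h2]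
        simp only [zero_mul, mul_zero, Finset.sum_const_zero]
    · rw [indicator_of_notMem (fun h => h1 h.1), ind_of_not_mem h1]; ring
  simp only [hL, hR]
  exact key

/-- The tower property on `D ∩ {s ↔ t}` and on `D` (`{s ↔ t}` and `univ` are `σ(C_s)`-events: `s ↔ t` iff `t = s` or an edge of `C_s` contains `t`).
[cite: VandenbergHaggstromKahn2005, §2.1 Lemma 2.4 (p. 10); §1 p. 3] -/
theorem setIntegral_jointFn_reach_eq (w : Sym2 V → unitInterval) (s t : V) (X : Set V) (f : Set (Sym2 V) → Set (Sym2 V) → ℝ) :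
    (∫ ω in {ω : BondConfig V | ∀ x ∈ X, ¬ (openGraph ω).Reachable s x} ∩ openConn s t,
        f (openEdgeCluster ω s) (⋃ x ∈ X, openEdgeCluster ω x) ∂(prodBernoulli w) =
      ∫ ω in {ω : BondConfig V | ∀ x ∈ X, ¬ (openGraph ω).Reachable s x} ∩ openConn s t,
        (∫ η, f (openEdgeCluster ω s) (setCl (η \ barOf ({s} : Set V) (openEdgeCluster ω s)) X) ∂(prodBernoulli w))
          ∂(prodBernoulli w)) ∧
    (∫ ω in {ω : BondConfig V | ∀ x ∈ X, ¬ (openGraph ω).Reachable s x},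
        f (openEdgeCluster ω s) (⋃ x ∈ X, openEdgeCluster ω x) ∂(prodBernoulli w) =
      ∫ ω in {ω : BondConfig V | ∀ x ∈ X, ¬ (openGraph ω).Reachable s x},
        (∫ η, f (openEdgeCluster ω s) (setCl (η \ barOf ({s} : Set V) (openEdgeCluster ω s)) X) ∂(prodBernoulli w))
          ∂(prodBernoulli w)) := by
  constructor
  · have hset : ({ω : BondConfig V | ∀ x ∈ X, ¬ (openGraph ω).Reachable s x} ∩ openConn s t) =
        {ω : BondConfig V | ∀ x ∈ X, ¬ (openGraph ω).Reachable s x} ∩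
          {ω | openEdgeCluster ω s ∈ {K : Set (Sym2 V) | t = s ∨ ∃ e ∈ K, t ∈ e}} := by
      ext ω
      simp only [mem_inter_iff, mem_setOf_eq, openConn, reachable_iff_exists_mem_openEdgeCluster]
    rw [hset]
    exact tower_jointFn w s X f _
  · have hset : {ω : BondConfig V | ∀ x ∈ X, ¬ (openGraph ω).Reachable s x} =
        {ω : BondConfig V | ∀ x ∈ X, ¬ (openGraph ω).Reachable s x} ∩ {ω | openEdgeCluster ω s ∈ (univ : Set (Set (Sym2 V)))} := by
      ext ω; simp
    rw [hset]
    exact tower_jointFn w s X f _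

/-- **THE TOWER REDUCTION (pointwise form).**  If the MDL(X)′ inequality holds at the increasing functional `f̂(K) = ∫ f(K, C_X(η ∖ B(K))) dμ(η)`,
then it holds for the Thm-2.1-class integrand `f(C_s, C_X)` (same `w, s, y, z, X`): the three integrals coincide.
[cite: VandenbergHaggstromKahn2005, §2.1 Lemma 2.4 (p. 10), Thm. 2.1 (p. 9)] -/
theorem mdlxJoint_jointClass_of_at (w : Sym2 V → unitInterval) (s y z : V) (X : Set V) (f : Set (Sym2 V) → Set (Sym2 V) → ℝ)
    (h : (prodBernoulli w).real ({ω : BondConfig V | ∀ x ∈ insert s X, ¬ (openGraph ω).Reachable y x} ∩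
          {ω | ∀ x ∈ X, ¬ (openGraph ω).Reachable s x} ∩ openConn y z) *
        ((prodBernoulli w).real {ω : BondConfig V | ∀ x ∈ X, ¬ (openGraph ω).Reachable s x} *
            (∫ ω in {ω : BondConfig V | ∀ x ∈ X, ¬ (openGraph ω).Reachable s x} ∩ openConn s y,
              (∫ η, f (openEdgeCluster ω s) (setCl (η \ barOf ({s} : Set V) (openEdgeCluster ω s)) X) ∂(prodBernoulli w))
                ∂(prodBernoulli w)) -
          (∫ ω in {ω : BondConfig V | ∀ x ∈ X, ¬ (openGraph ω).Reachable s x},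
              (∫ η, f (openEdgeCluster ω s) (setCl (η \ barOf ({s} : Set V) (openEdgeCluster ω s)) X) ∂(prodBernoulli w))
                ∂(prodBernoulli w)) *
            (prodBernoulli w).real ({ω : BondConfig V | ∀ x ∈ X, ¬ (openGraph ω).Reachable s x} ∩ openConn s y)) ≤
      (prodBernoulli w).real ({ω : BondConfig V | ∀ x ∈ insert s X, ¬ (openGraph ω).Reachable y x} ∩
          {ω | ∀ x ∈ X, ¬ (openGraph ω).Reachable s x}) *
        ((prodBernoulli w).real {ω : BondConfig V | ∀ x ∈ X, ¬ (openGraph ω).Reachable s x} *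
            (∫ ω in {ω : BondConfig V | ∀ x ∈ X, ¬ (openGraph ω).Reachable s x} ∩ openConn s z,
              (∫ η, f (openEdgeCluster ω s) (setCl (η \ barOf ({s} : Set V) (openEdgeCluster ω s)) X) ∂(prodBernoulli w))
                ∂(prodBernoulli w)) -
          (∫ ω in {ω : BondConfig V | ∀ x ∈ X, ¬ (openGraph ω).Reachable s x},
              (∫ η, f (openEdgeCluster ω s) (setCl (η \ barOf ({s} : Set V) (openEdgeCluster ω s)) X) ∂(prodBernoulli w))
                ∂(prodBernoulli w)) *
            (prodBernoulli w).real ({ω : BondConfig V | ∀ x ∈ X, ¬ (openGraph ω).Reachable s x} ∩ openConn s z))) :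
    (prodBernoulli w).real ({ω : BondConfig V | ∀ x ∈ insert s X, ¬ (openGraph ω).Reachable y x} ∩
          {ω | ∀ x ∈ X, ¬ (openGraph ω).Reachable s x} ∩ openConn y z) *
        ((prodBernoulli w).real {ω : BondConfig V | ∀ x ∈ X, ¬ (openGraph ω).Reachable s x} *
            (∫ ω in {ω : BondConfig V | ∀ x ∈ X, ¬ (openGraph ω).Reachable s x} ∩ openConn s y,
              f (openEdgeCluster ω s) (⋃ x ∈ X, openEdgeCluster ω x) ∂(prodBernoulli w)) -
          (∫ ω in {ω : BondConfig V | ∀ x ∈ X, ¬ (openGraph ω).Reachable s x},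
              f (openEdgeCluster ω s) (⋃ x ∈ X, openEdgeCluster ω x) ∂(prodBernoulli w)) *
            (prodBernoulli w).real ({ω : BondConfig V | ∀ x ∈ X, ¬ (openGraph ω).Reachable s x} ∩ openConn s y)) ≤
      (prodBernoulli w).real ({ω : BondConfig V | ∀ x ∈ insert s X, ¬ (openGraph ω).Reachable y x} ∩
          {ω | ∀ x ∈ X, ¬ (openGraph ω).Reachable s x}) *
        ((prodBernoulli w).real {ω : BondConfig V | ∀ x ∈ X, ¬ (openGraph ω).Reachable s x} *
            (∫ ω in {ω : BondConfig V | ∀ x ∈ X, ¬ (openGraph ω).Reachable s x} ∩ openConn s z,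
              f (openEdgeCluster ω s) (⋃ x ∈ X, openEdgeCluster ω x) ∂(prodBernoulli w)) -
          (∫ ω in {ω : BondConfig V | ∀ x ∈ X, ¬ (openGraph ω).Reachable s x},
              f (openEdgeCluster ω s) (⋃ x ∈ X, openEdgeCluster ω x) ∂(prodBernoulli w)) *
            (prodBernoulli w).real ({ω : BondConfig V | ∀ x ∈ X, ¬ (openGraph ω).Reachable s x} ∩ openConn s z)) := by
  rw [(setIntegral_jointFn_reach_eq w s y X f).1, (setIntegral_jointFn_reach_eq w s z X f).1,
    (setIntegral_jointFn_reach_eq w s y X f).2]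
  exact h

/-- **`Consts.MDLXJoint` ⟹ MDLX-J (the vdBHK Thm 2.1 class).**  If MDL(X)′ holds (for all monotone functionals of `C_s`), then for every
`f(K, L)` increasing in `K` and decreasing in `L`:
`μ(𝒜∩D∩W)·cov_D(f(C_s, C_X); s↔y) ≤ μ(𝒜∩D)·cov_D(f(C_s, C_X); s↔z)`, `C_X = ⋃_{x∈X} C_x`.
[cite: VandenbergHaggstromKahn2005, Thm. 2.1 (p. 9), §2.1 Lemma 2.4 (p. 10)] -/
theorem mdlxJoint_jointClass (hM : MDLXJoint) (n : ℕ) (w : Sym2 (Fin n) → unitInterval) (s y z : Fin n) (X : Set (Fin n))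
    (hsy : s ≠ y) (f : Set (Sym2 (Fin n)) → Set (Sym2 (Fin n)) → ℝ)
    (hf₁ : ∀ L, Monotone fun K => f K L) (hf₂ : ∀ K, Antitone fun L => f K L) :
    (prodBernoulli w).real ({ω : BondConfig (Fin n) | ∀ x ∈ insert s X, ¬ (openGraph ω).Reachable y x} ∩
          {ω | ∀ x ∈ X, ¬ (openGraph ω).Reachable s x} ∩ openConn y z) *
        ((prodBernoulli w).real {ω : BondConfig (Fin n) | ∀ x ∈ X, ¬ (openGraph ω).Reachable s x} *
            (∫ ω in {ω : BondConfig (Fin n) | ∀ x ∈ X, ¬ (openGraph ω).Reachable s x} ∩ openConn s y,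
              f (openEdgeCluster ω s) (⋃ x ∈ X, openEdgeCluster ω x) ∂(prodBernoulli w)) -
          (∫ ω in {ω : BondConfig (Fin n) | ∀ x ∈ X, ¬ (openGraph ω).Reachable s x},
              f (openEdgeCluster ω s) (⋃ x ∈ X, openEdgeCluster ω x) ∂(prodBernoulli w)) *
            (prodBernoulli w).real ({ω : BondConfig (Fin n) | ∀ x ∈ X, ¬ (openGraph ω).Reachable s x} ∩ openConn s y)) ≤
      (prodBernoulli w).real ({ω : BondConfig (Fin n) | ∀ x ∈ insert s X, ¬ (openGraph ω).Reachable y x} ∩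
          {ω | ∀ x ∈ X, ¬ (openGraph ω).Reachable s x}) *
        ((prodBernoulli w).real {ω : BondConfig (Fin n) | ∀ x ∈ X, ¬ (openGraph ω).Reachable s x} *
            (∫ ω in {ω : BondConfig (Fin n) | ∀ x ∈ X, ¬ (openGraph ω).Reachable s x} ∩ openConn s z,
              f (openEdgeCluster ω s) (⋃ x ∈ X, openEdgeCluster ω x) ∂(prodBernoulli w)) -
          (∫ ω in {ω : BondConfig (Fin n) | ∀ x ∈ X, ¬ (openGraph ω).Reachable s x},
              f (openEdgeCluster ω s) (⋃ x ∈ X, openEdgeCluster ω x) ∂(prodBernoulli w)) *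
            (prodBernoulli w).real ({ω : BondConfig (Fin n) | ∀ x ∈ X, ¬ (openGraph ω).Reachable s x} ∩ openConn s z)) :=
  mdlxJoint_jointClass_of_at w s y z X f
    (hM n w s y z X hsy (fun K => ∫ η, f K (setCl (η \ barOf ({s} : Set (Fin n)) K) X) ∂(prodBernoulli w))
      (monotone_condJointFn w s X f hf₁ hf₂))

/-- **`Consts.MDLXJoint` ⟹ J2** (the covariance half of the cylinder split, at every decreasing functional of the avoided cluster): for `g`
antitone, `μ(𝒜∩D∩W)·cov_D(g(C_X); s↔y) ≤ μ(𝒜∩D)·cov_D(g(C_X); s↔z)`; e.g. `g = 1{u ∉ V(C_X)}` gives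
`Cov_ν(1{u↮X}, 1{s↔z}) ≥ p'·Cov_ν(1{u↮X}, 1{s↔y})`.  [cite: VandenbergHaggstromKahn2005, Thm. 2.1 (p. 9), §2.1 Lemma 2.4 (p. 10)] -/
theorem mdlxJoint_J2 (hM : MDLXJoint) (n : ℕ) (w : Sym2 (Fin n) → unitInterval) (s y z : Fin n) (X : Set (Fin n))
    (hsy : s ≠ y) (g : Set (Sym2 (Fin n)) → ℝ) (hg : Antitone g) :
    (prodBernoulli w).real ({ω : BondConfig (Fin n) | ∀ x ∈ insert s X, ¬ (openGraph ω).Reachable y x} ∩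
          {ω | ∀ x ∈ X, ¬ (openGraph ω).Reachable s x} ∩ openConn y z) *
        ((prodBernoulli w).real {ω : BondConfig (Fin n) | ∀ x ∈ X, ¬ (openGraph ω).Reachable s x} *
            (∫ ω in {ω : BondConfig (Fin n) | ∀ x ∈ X, ¬ (openGraph ω).Reachable s x} ∩ openConn s y,
              g (⋃ x ∈ X, openEdgeCluster ω x) ∂(prodBernoulli w)) -
          (∫ ω in {ω : BondConfig (Fin n) | ∀ x ∈ X, ¬ (openGraph ω).Reachable s x},
              g (⋃ x ∈ X, openEdgeCluster ω x) ∂(prodBernoulli w)) *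
            (prodBernoulli w).real ({ω : BondConfig (Fin n) | ∀ x ∈ X, ¬ (openGraph ω).Reachable s x} ∩ openConn s y)) ≤
      (prodBernoulli w).real ({ω : BondConfig (Fin n) | ∀ x ∈ insert s X, ¬ (openGraph ω).Reachable y x} ∩
          {ω | ∀ x ∈ X, ¬ (openGraph ω).Reachable s x}) *
        ((prodBernoulli w).real {ω : BondConfig (Fin n) | ∀ x ∈ X, ¬ (openGraph ω).Reachable s x} *
            (∫ ω in {ω : BondConfig (Fin n) | ∀ x ∈ X, ¬ (openGraph ω).Reachable s x} ∩ openConn s z,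
              g (⋃ x ∈ X, openEdgeCluster ω x) ∂(prodBernoulli w)) -
          (∫ ω in {ω : BondConfig (Fin n) | ∀ x ∈ X, ¬ (openGraph ω).Reachable s x},
              g (⋃ x ∈ X, openEdgeCluster ω x) ∂(prodBernoulli w)) *
            (prodBernoulli w).real ({ω : BondConfig (Fin n) | ∀ x ∈ X, ¬ (openGraph ω).Reachable s x} ∩ openConn s z)) :=
  mdlxJoint_jointClass hM n w s y z X hsy (fun _ L => g L) (fun _ => monotone_const) (fun _ => hg)

end Consts

end Summit.CriticalPhenomena.PercolationContinuityZ3.Theorems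

end
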